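import Summits.ValiantsHypothesis.ValiantsHypothesis.Theorems.SymPencilPerFourColSixForms

/-!
# Route `SymPencil` — the column-deleted two-row space `W_col` at size `27`, III: the base-point
# identity along a genuinely TWO-ROW kernel direction (`--supports` stmt-ValiantsHypothesis-5674
# `SdcSuperquadratic`; cell `(10,6,6)`, rung currency only, nothing here bears on `VP ≠ VNP`)

For `v = t' a + t b` with `a = E₀₁+E₀₂+E₀₃` and `b = β₁E₁₁+β₂E₁₂+β₃E₁₃` (a two-row element of
`W_col`, NOT an affine direction of `per_4` in general) the restriction `s ↦ per_4 (z + s v)` is an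
explicit QUADRATIC polynomial (`eval_tworow_quadratic`): its `s²`-coefficient is
`t t' Σ_m s_m (z₂₀ z₃ₘ + z₂ₘ z₃₀)` with `s = (β₂+β₃, β₁+β₃, β₁+β₂) = (𝟙𝟙ᵀ-1)β`.  Feeding this
into `SymPencilBasePointFamily.basepoint_family` gives (`tworow_basepoint_form`) the bilinear
identity `det(D + CL v) · bL z ⬝ (D + CL v)⁻¹ bL z' = -κ · B_v(z, z')` with the explicit polar
form `B_v`; these are steps (2)–(3) of the pair argument of
`Cruxes/SdcSuperquadratic/PENCIL-CROSS-27.md` rev 4 §W_col.  No definitions, no named facts.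
[folklore]
-/

noncomputable section

-- single-conjunct layout: Sub = Summit, duplicated namespace component intended
set_option linter.dupNamespace false

namespace Summit.ValiantsHypothesis.ValiantsHypothesis.Theorems.SymPencilPerFourColSixTwoRow

open Matrix MvPolynomial Module
open Literature.Computability.AlgebraicComplexity
open Summit.ValiantsHypothesis.ValiantsHypothesis.Theorems.SymPencilLagrangianKernel
open Summit.ValiantsHypothesis.ValiantsHypothesis.Theorems.SymPencilBasePointFamily

universe u

variable {k : Type u} [Field k]

/-- **`per_4` along a two-row direction of `W_col` is quadratic**, with explicit coefficients.
[folklore] -/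
theorem eval_tworow_quadratic (z : Fin 4 × Fin 4 → k) (β₁ β₂ β₃ t t' s : k) :
    MvPolynomial.eval (z + s • (fun w : Fin 4 × Fin 4 =>
        (Matrix.of ![![0, t', t', t'], ![0, t * β₁, t * β₂, t * β₃], ![0, 0, 0, 0], ![0, 0, 0, 0]])
          w.1 w.2)) (perPoly (Fin 4) k) =
      MvPolynomial.eval z (perPoly (Fin 4) k) +
      s * (
        β₁ * t * z (0, 0) * z (2, 2) * z (3, 3) + β₁ * t * z (0, 0) * z (2, 3) * z (3, 2) +
        β₁ * t * z (0, 2) * z (2, 0) * z (3, 3) + β₁ * t * z (0, 2) * z (2, 3) * z (3, 0) +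
        β₁ * t * z (0, 3) * z (2, 0) * z (3, 2) + β₁ * t * z (0, 3) * z (2, 2) * z (3, 0) +
        β₂ * t * z (0, 0) * z (2, 1) * z (3, 3) + β₂ * t * z (0, 0) * z (2, 3) * z (3, 1) +
        β₂ * t * z (0, 1) * z (2, 0) * z (3, 3) + β₂ * t * z (0, 1) * z (2, 3) * z (3, 0) +
        β₂ * t * z (0, 3) * z (2, 0) * z (3, 1) + β₂ * t * z (0, 3) * z (2, 1) * z (3, 0) +
        β₃ * t * z (0, 0) * z (2, 1) * z (3, 2) + β₃ * t * z (0, 0) * z (2, 2) * z (3, 1) +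
        β₃ * t * z (0, 1) * z (2, 0) * z (3, 2) + β₃ * t * z (0, 1) * z (2, 2) * z (3, 0) +
        β₃ * t * z (0, 2) * z (2, 0) * z (3, 1) + β₃ * t * z (0, 2) * z (2, 1) * z (3, 0) +
        t' * z (1, 0) * z (2, 1) * z (3, 2) + t' * z (1, 0) * z (2, 1) * z (3, 3) +
        t' * z (1, 0) * z (2, 2) * z (3, 1) + t' * z (1, 0) * z (2, 2) * z (3, 3) +
        t' * z (1, 0) * z (2, 3) * z (3, 1) + t' * z (1, 0) * z (2, 3) * z (3, 2) +
        t' * z (1, 1) * z (2, 0) * z (3, 2) + t' * z (1, 1) * z (2, 0) * z (3, 3) +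
        t' * z (1, 1) * z (2, 2) * z (3, 0) + t' * z (1, 1) * z (2, 3) * z (3, 0) +
        t' * z (1, 2) * z (2, 0) * z (3, 1) + t' * z (1, 2) * z (2, 0) * z (3, 3) +
        t' * z (1, 2) * z (2, 1) * z (3, 0) + t' * z (1, 2) * z (2, 3) * z (3, 0) +
        t' * z (1, 3) * z (2, 0) * z (3, 1) + t' * z (1, 3) * z (2, 0) * z (3, 2) +
        t' * z (1, 3) * z (2, 1) * z (3, 0) + t' * z (1, 3) * z (2, 2) * z (3, 0)) +
      s ^ 2 * (t * t' * ((β₂ + β₃) * (z (2, 0) * z (3, 1) + z (2, 1) * z (3, 0)) +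
        (β₁ + β₃) * (z (2, 0) * z (3, 2) + z (2, 2) * z (3, 0)) +
        (β₁ + β₂) * (z (2, 0) * z (3, 3) + z (2, 3) * z (3, 0)))) := by
  simp only [eval_perPoly, Matrix.permanent_fin_four_row, Matrix.of_apply, Pi.add_apply,
    Pi.smul_apply, smul_eq_mul]
  simp
  ring

variable [CharZero k] {ι' : Type*} [Fintype ι'] [DecidableEq ι']

/-- **The base-point identity along a two-row kernel direction** (polarised): for
`v = t' a + t b` as above with `bL v = 0`,
`det (D + CL v) · (bL z ⬝ (D + CL v)⁻¹ bL z') = -κ · B_v(z,z')` with the explicit polar form of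
the `s²`-coefficient. [folklore] -/
theorem tworow_basepoint_form {D : Matrix ι' ι' k} (hDs : Dᵀ = D)
    (bL : (Fin 4 × Fin 4 → k) →ₗ[k] (ι' → k)) (CL : (Fin 4 × Fin 4 → k) →ₗ[k] Matrix ι' ι' k)
    (hCs : ∀ z, (CL z)ᵀ = CL z) {κ : k} (hκ : κ ≠ 0)
    (hN : ∀ v, bL v = 0 → IsUnit (D + CL v).det ∧ ∀ (z : Fin 4 × Fin 4 → k) (s : k),
      κ * MvPolynomial.eval (v + s • z) (perPoly (Fin 4) k) =
        (Matrix.fromBlocks ((s * 0) • (1 : Matrix Unit Unit k))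
          (Matrix.replicateRow Unit (s • bL z)) (Matrix.replicateCol Unit (s • bL z))
          (D + CL v + s • CL z)).det)
    (β₁ β₂ β₃ t t' : k)
    (hv : bL (fun w : Fin 4 × Fin 4 =>
        (Matrix.of ![![0, t', t', t'], ![0, t * β₁, t * β₂, t * β₃], ![0, 0, 0, 0], ![0, 0, 0, 0]])
          w.1 w.2) = 0)
    (z z' : Fin 4 × Fin 4 → k) :
    (D + CL (fun w : Fin 4 × Fin 4 =>
        (Matrix.of ![![0, t', t', t'], ![0, t * β₁, t * β₂, t * β₃], ![0, 0, 0, 0], ![0, 0, 0, 0]])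
          w.1 w.2)).det *
      (bL z ⬝ᵥ (D + CL (fun w : Fin 4 × Fin 4 =>
        (Matrix.of ![![0, t', t', t'], ![0, t * β₁, t * β₂, t * β₃], ![0, 0, 0, 0], ![0, 0, 0, 0]])
          w.1 w.2))⁻¹ *ᵥ bL z') =
      -(κ * (t * t' * ((β₂ + β₃) * (z (2, 0) * z' (3, 1) + z' (2, 0) * z (3, 1) +
          z (2, 1) * z' (3, 0) + z' (2, 1) * z (3, 0)) +
        (β₁ + β₃) * (z (2, 0) * z' (3, 2) + z' (2, 0) * z (3, 2) +
          z (2, 2) * z' (3, 0) + z' (2, 2) * z (3, 0)) +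
        (β₁ + β₂) * (z (2, 0) * z' (3, 3) + z' (2, 0) * z (3, 3) +
          z (2, 3) * z' (3, 0) + z' (2, 3) * z (3, 0))) / 2)) := by
  set v : Fin 4 × Fin 4 → k := fun w : Fin 4 × Fin 4 =>
    (Matrix.of ![![0, t', t', t'], ![0, t * β₁, t * β₂, t * β₃], ![0, 0, 0, 0], ![0, 0, 0, 0]])
      w.1 w.2 with hvdef
  -- the quadratic form `S(w) := s²-coefficient`
  have hS : ∀ w : Fin 4 × Fin 4 → k, (D + CL v).det * (bL w ⬝ᵥ (D + CL v)⁻¹ *ᵥ bL w) =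
      -(κ * (t * t' * ((β₂ + β₃) * (w (2, 0) * w (3, 1) + w (2, 1) * w (3, 0)) +
        (β₁ + β₃) * (w (2, 0) * w (3, 2) + w (2, 2) * w (3, 0)) +
        (β₁ + β₂) * (w (2, 0) * w (3, 3) + w (2, 3) * w (3, 0))))) := by
    intro w
    exact (basepoint_family bL CL hN hκ v hv w _ _ _
      (fun s => by rw [hvdef]; exact eval_tworow_quadratic w β₁ β₂ β₃ t t' s)).1
  have hsym : ((D + CL v)⁻¹)ᵀ = (D + CL v)⁻¹ := by
    rw [Matrix.transpose_nonsing_inv, Matrix.transpose_add, hDs, hCs]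
  have hsw : bL z' ⬝ᵥ (D + CL v)⁻¹ *ᵥ bL z = bL z ⬝ᵥ (D + CL v)⁻¹ *ᵥ bL z' := by
    rw [dotProduct_mulVec_of_transpose_eq hsym, dotProduct_comm]
  have h1 := hS (z + z')
  have h2 := hS z
  have h3 := hS z'
  rw [map_add, Matrix.mulVec_add, dotProduct_add, add_dotProduct, add_dotProduct, hsw] at h1
  simp only [Pi.add_apply] at h1
  linear_combination (h1 - h2 - h3) / 2

end Summit.ValiantsHypothesis.ValiantsHypothesis.Theorems.SymPencilPerFourColSixTwoRow

end
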